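import Literature.Probability.Process.CondExpBayes
import Mathlib.MeasureTheory.Integral.Prod
import HarnessLib

/-!
# Conditional expectation given one coordinate of a product law
# (the independent-fibre case of the disintegration theorem — no standard-Borel hypothesis)

[topic Probability/Process]

Let `μ` be a finite measure on `(Ω, 𝓐)` and `T : Ω → A`, `S : Ω → B` measurable maps whose JOINT law
is a PRODUCT: `μ ∘ (T, S)⁻¹ = ν ⊗ π` with `ν` a probability on `A` and `π` s-finite on `B` (so `π` is
the law of `S` and, after normalisation, `T` and `S` are independent with `T ~ ν`).  Then for every
`ν ⊗ π`-integrable `F : A × B → E` (real Banach `E`)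

  `μ[F(T, S) | σ(S)] = (∫ F(a, S ·) ν(da))`   `μ`-a.e.      (`condExp_comap_ae_eq_integral_of_map_prod`)

— Kallenberg's disintegration formula `E[f(ξ,η) | η] = ∫ μ(η, ds) f(s, η)` (FMP, 2nd ed., Thm 6.4,
eq. (6)) in the independent case, where the conditional distribution `P[ξ ∈ · | η]` is the CONSTANT
kernel `L(ξ) = ν` (ibid. Lemma 3.11 (conditioning): `E f(ξ,η) = E(E f(s,η))_{s=ξ}` for `ξ ⊥⊥ η`).  In
this case no regular conditional distribution has to be produced, so NO standard-Borel / Polish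
hypothesis on any of the spaces is needed: the proof is the defining property of the conditional
expectation on the sets `S⁻¹(B₀)` plus Fubini (`ae_eq_condExp_of_forall_setIntegral_eq`,
`integral_prod_symm`).  Mathlib's general route (`ProbabilityTheory.condExp_prod_ae_eq_integral_condDistrib`,
`condDistrib_ae_eq_of_measure_eq_compProd`) goes through `condDistrib` and asks for
`[StandardBorelSpace]` on the fibre coordinate; the present file is the hypothesis-free special case.

Two corollaries in the shape lattice models use («resample the fibre, keep the coarse variable»):

* `condExp_comap_ae_eq_integral_comp_recon` — if `R : A × B → Ω` is a measurable reconstruction map,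
  `R (T ω, S ω) = ω`, then `μ[f | σ(S)] = (ω ↦ ∫ f (R (a, S ω)) ν(da))` a.e. for every `μ`-integrable
  strongly measurable `f`;
* `condExp_comap_tilted_ae_eq` — for the exponentially tilted (Gibbs) measure `μ.tilted g`
  (`g` measurable, `e^{g}` `μ`-integrable) the conditional expectation given `σ(S)` is the FIBRE GIBBS
  AVERAGE `(∫ e^{g(R(a,S·))} ν(da))⁻¹ • ∫ e^{g(R(a,S·))} f(R(a,S·)) ν(da)` — the previous corollary fed into
  the abstract Bayes formula `condExp_tilted_ae_eq_smul` of `CondExpBayes.lean` (Bain–Crisan 2009,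
  Prop. 3.16).

Design: `σ(S)` is written `MeasurableSpace.comap S inferInstance` (the tree's phrasing in the lattice
files); the integrand is taken strongly measurable on the nose (not merely a.e.) so that the right-hand
sides are honest pointwise functions of `S`.  Deliberately NOT here: the general disintegration theorem
with a non-constant kernel (that is Mathlib's `condDistrib` API), and any lattice / gauge-theory instance.

## References
* O. Kallenberg, *Foundations of Modern Probability*, 2nd ed., Springer (2002): Ch. 6, Thm 6.4
  (disintegration), eq. (5)–(6); Ch. 3, Lemma 3.11 (conditioning) and Lemma 3.10 (product measures).
  (Corpus copy `book:kallenberg2021-foundations-modern-probability-3rd-ed` carries the 2nd-edition text: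
  Thm 6.4 at chunk p0125, Lemma 3.11 at chunk p0068.)
* A. Bain, D. Crisan, *Fundamentals of Stochastic Filtering*, Springer (2009), Prop. 3.16 — via
  `Literature.Probability.Process.condExp_tilted_ae_eq_smul`.
-/

open MeasureTheory Filter Set
open scoped ENNReal

namespace Literature.Probability.Process

variable {Ω A B E : Type*} [MeasurableSpace Ω] [MeasurableSpace A] [MeasurableSpace B]
  [NormedAddCommGroup E] [NormedSpace ℝ E] [CompleteSpace E]
  {μ : Measure Ω} {T : Ω → A} {S : Ω → B} {ν : Measure A} {π : Measure B}

/-- If the joint law of `(T, S)` under `μ` is `ν ⊗ π` with `ν` a probability measure, then the law of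
`S` under `μ` is `π` (second marginal of a product measure; private plumbing). [folklore] -/
private theorem map_eq_of_map_prod_eq [IsProbabilityMeasure ν] [SFinite π]
    (hT : Measurable T) (hS : Measurable S)
    (hJ : μ.map (fun ω => (T ω, S ω)) = ν.prod π) : μ.map S = π := by
  have hc : S = Prod.snd ∘ fun ω => (T ω, S ω) := rfl
  rw [hc, ← Measure.map_map measurable_snd (hT.prodMk hS), hJ, Measure.map_snd_prod, measure_univ,
    one_smul]

/-- **Conditional expectation given one coordinate of a product law** (Kallenberg, FMP 2nd ed.,
Thm 6.4 (disintegration), eq. (6), in the independent case of Lemma 3.11 (conditioning), where the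
conditional distribution of `ξ = T` given `η = S` is the constant kernel `ν`): if `μ` is a finite
measure, `T`, `S` are measurable, the joint law `μ ∘ (T,S)⁻¹` is the product `ν ⊗ π` of a probability
measure `ν` and an s-finite measure `π`, and `F : A × B → E` is strongly measurable and
`ν ⊗ π`-integrable, then `μ[F(T,S) | σ(S)] = ∫ F(a, S ·) dν(a)` `μ`-almost everywhere.  No
standard-Borel hypothesis on `Ω`, `A` or `B`. [cite: Kallenberg2002, Thm 6.4 eq. (6); Lemma 3.11] -/
theorem condExp_comap_ae_eq_integral_of_map_prod [IsFiniteMeasure μ] [IsProbabilityMeasure ν]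
    [SFinite π] (hT : Measurable T) (hS : Measurable S)
    (hJ : μ.map (fun ω => (T ω, S ω)) = ν.prod π)
    {F : A × B → E} (hF : StronglyMeasurable F) (hFi : Integrable F (ν.prod π)) :
    μ[fun ω => F (T ω, S ω) | MeasurableSpace.comap S inferInstance]
      =ᵐ[μ] fun ω => ∫ a, F (a, S ω) ∂ν := by
  have hpair : Measurable (fun ω => (T ω, S ω)) := hT.prodMk hS
  have hsd : μ.map S = π := map_eq_of_map_prod_eq hT hS hJ
  -- integrability of `F ∘ (T, S)` under `μ`, read off the joint law
  have hfi : Integrable (fun ω => F (T ω, S ω)) μ := by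
    have h1 : Integrable F (μ.map fun ω => (T ω, S ω)) := by rw [hJ]; exact hFi
    exact (integrable_map_measure hF.aestronglyMeasurable hpair.aemeasurable).1 h1
  -- the fibre integral as a function of the coarse variable
  set Ψ : B → E := fun s => ∫ a, F (a, s) ∂ν with hΨ_def
  have hΨm : StronglyMeasurable Ψ := hF.integral_prod_left'
  have hΨi : Integrable Ψ π := hFi.integral_prod_right
  have hΨS : Integrable (fun ω => Ψ (S ω)) μ := by
    have h1 : Integrable Ψ (μ.map S) := by rw [hsd]; exact hΨi
    exact (integrable_map_measure hΨm.aestronglyMeasurable hS.aemeasurable).1 h1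
  have hm : MeasurableSpace.comap S inferInstance ≤ (inferInstance : MeasurableSpace Ω) :=
    hS.comap_le
  have hSm : Measurable[MeasurableSpace.comap S inferInstance] S :=
    measurable_iff_comap_le.2 le_rfl
  have hgm : StronglyMeasurable[MeasurableSpace.comap S inferInstance] (fun ω => Ψ (S ω)) :=
    hΨm.comp_measurable hSm
  refine (ae_eq_condExp_of_forall_setIntegral_eq hm hfi (fun s _ _ => hΨS.integrableOn) ?_
    hgm.aestronglyMeasurable).symm
  -- the `σ(S)`-measurable sets are the preimages `S ⁻¹' B₀`
  rintro _ ⟨B₀, hB₀, rfl⟩ -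
  have hpre : MeasurableSet (S ⁻¹' B₀) := hS hB₀
  rw [← integral_indicator hpre, ← integral_indicator hpre]
  have hBm : MeasurableSet (Prod.snd ⁻¹' B₀ : Set (A × B)) := measurable_snd hB₀
  -- left side: `∫ 1_{B₀}(S) Ψ(S) dμ = ∫ 1_{B₀} Ψ dπ`
  have lhs : ∫ ω, (S ⁻¹' B₀).indicator (fun ω => Ψ (S ω)) ω ∂μ = ∫ s, B₀.indicator Ψ s ∂π := by
    have h1 : (S ⁻¹' B₀).indicator (fun ω => Ψ (S ω)) = fun ω => B₀.indicator Ψ (S ω) := by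
      funext ω; exact Set.indicator_comp_right (s := B₀) S (g := Ψ) (x := ω)
    rw [h1, ← hsd, integral_map hS.aemeasurable]
    exact (hΨm.indicator hB₀).aestronglyMeasurable
  -- right side: `∫ 1_{B₀}(S) F(T,S) dμ = ∫∫ 1_{B₀}(s) F(a,s) dν(a) dπ(s) = ∫ 1_{B₀} Ψ dπ` (Fubini)
  have rhs : ∫ ω, (S ⁻¹' B₀).indicator (fun ω => F (T ω, S ω)) ω ∂μ = ∫ s, B₀.indicator Ψ s ∂π := by
    have h1 : (S ⁻¹' B₀).indicator (fun ω => F (T ω, S ω))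
        = fun ω => (Prod.snd ⁻¹' B₀ : Set (A × B)).indicator F (T ω, S ω) := by
      funext ω
      exact Set.indicator_comp_right (s := (Prod.snd ⁻¹' B₀ : Set (A × B)))
        (fun ω => (T ω, S ω)) (g := F) (x := ω)
    rw [h1, ← integral_map hpair.aemeasurable ((hF.indicator hBm).aestronglyMeasurable), hJ,
      integral_prod_symm _ (hFi.indicator hBm)]
    refine integral_congr_ae (Eventually.of_forall (fun s => ?_))
    by_cases hs : s ∈ B₀
    · simp only [Set.indicator_of_mem hs, hΨ_def]
      refine integral_congr_ae (Eventually.of_forall (fun a => ?_))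
      exact Set.indicator_of_mem (by exact hs) F
    · simp only [Set.indicator_of_notMem hs]
      rw [← integral_zero (α := A) E]
      refine integral_congr_ae (Eventually.of_forall (fun a => ?_))
      exact Set.indicator_of_notMem (by exact hs) F
  rw [lhs, rhs]

/-- **Resampling the fibre along a reconstruction map** (corollary of
`condExp_comap_ae_eq_integral_of_map_prod`; Kallenberg FMP 2nd ed. Thm 6.4 eq. (6) / Lemma 3.11 in
the independent case): if moreover `R : A × B → Ω` is measurable with `R (T ω, S ω) = ω` for all `ω`
(so `(T, S)` is a measurable bijection onto its image with inverse `R`), then for every strongly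
measurable `μ`-integrable `f : Ω → E`,
`μ[f | σ(S)] = (ω ↦ ∫ f (R (a, S ω)) dν(a))` `μ`-almost everywhere: the conditional expectation given
the coarse variable `S` is the average of `f` over the fibre, the fibre coordinate redrawn from `ν`.
[cite: Kallenberg2002, Thm 6.4 eq. (6); Lemma 3.11] -/
theorem condExp_comap_ae_eq_integral_comp_recon [IsFiniteMeasure μ] [IsProbabilityMeasure ν]
    [SFinite π] (hT : Measurable T) (hS : Measurable S)
    (hJ : μ.map (fun ω => (T ω, S ω)) = ν.prod π)
    {R : A × B → Ω} (hR : Measurable R) (hRTS : ∀ ω, R (T ω, S ω) = ω)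
    {f : Ω → E} (hfm : StronglyMeasurable f) (hfi : Integrable f μ) :
    μ[f | MeasurableSpace.comap S inferInstance] =ᵐ[μ] fun ω => ∫ a, f (R (a, S ω)) ∂ν := by
  have hpair : Measurable (fun ω => (T ω, S ω)) := hT.prodMk hS
  have hF : StronglyMeasurable (fun p : A × B => f (R p)) := hfm.comp_measurable hR
  have hrec : (fun ω => f (R (T ω, S ω))) = f := funext fun ω => congrArg f (hRTS ω)
  have hFi : Integrable (fun p : A × B => f (R p)) (ν.prod π) := by
    rw [← hJ]
    refine (integrable_map_measure hF.aestronglyMeasurable hpair.aemeasurable).2 ?_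
    have hc : (fun p : A × B => f (R p)) ∘ (fun ω => (T ω, S ω)) = f :=
      funext fun ω => congrArg f (hRTS ω)
    rw [hc]; exact hfi
  have h := condExp_comap_ae_eq_integral_of_map_prod (E := E) hT hS hJ hF hFi
  rw [hrec] at h
  exact h

/-- **Fibre Gibbs average = conditional expectation under the tilted measure** (the previous
corollary fed into the abstract Bayes formula `condExp_tilted_ae_eq_smul`, Bain–Crisan 2009
Prop. 3.16; Kallenberg FMP 2nd ed. Thm 6.4 eq. (6) for the reference measure): in the setting of
`condExp_comap_ae_eq_integral_comp_recon` with `μ ≠ 0`, let `g : Ω → ℝ` be measurable with `e^{g}`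
`μ`-integrable (e.g. `g = -β H` with `H` bounded measurable) and `f` strongly measurable and integrable
under the exponentially tilted measure `μ.tilted g = e^{g} μ / μ(e^{g})`.  Then, `μ.tilted g`-almost
everywhere,
`(μ.tilted g)[f | σ(S)] (ω) = (∫ e^{g(R(a,S ω))} dν(a))⁻¹ • ∫ e^{g(R(a,S ω))} • f(R(a,S ω)) dν(a)` —
the Gibbs average of `f` over the fibre of `S` with the fibre coordinate drawn from `ν`.
[cite: BainCrisan2009, Prop. 3.16; Kallenberg2002, Thm 6.4 eq. (6)] -/
theorem condExp_comap_tilted_ae_eq [IsFiniteMeasure μ] [NeZero μ] [IsProbabilityMeasure ν]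
    [SFinite π] (hT : Measurable T) (hS : Measurable S)
    (hJ : μ.map (fun ω => (T ω, S ω)) = ν.prod π)
    {R : A × B → Ω} (hR : Measurable R) (hRTS : ∀ ω, R (T ω, S ω) = ω)
    {g : Ω → ℝ} (hgm : Measurable g) (hg : Integrable (fun ω => Real.exp (g ω)) μ)
    {f : Ω → E} (hfm : StronglyMeasurable f) (hf : Integrable f (μ.tilted g)) :
    (μ.tilted g)[f | MeasurableSpace.comap S inferInstance] =ᵐ[μ.tilted g]
      fun ω => (∫ a, Real.exp (g (R (a, S ω))) ∂ν)⁻¹ •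
        ∫ a, Real.exp (g (R (a, S ω))) • f (R (a, S ω)) ∂ν := by
  have hm : MeasurableSpace.comap S inferInstance ≤ (inferInstance : MeasurableSpace Ω) :=
    hS.comap_le
  -- abstract Bayes formula for the tilt
  have key := condExp_tilted_ae_eq_smul (E := E) hm hgm hg hf
  -- the two `μ`-conditional expectations are fibre averages
  have hexp : StronglyMeasurable (fun ω => Real.exp (g ω)) := hgm.exp.stronglyMeasurable
  have h1 := condExp_comap_ae_eq_integral_comp_recon (E := ℝ) hT hS hJ hR hRTS hexp hg
  -- integrability of `e^{g} • f` under `μ` from that of `f` under the tilt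
  set Z : ℝ := ∫ ω, Real.exp (g ω) ∂μ with hZ
  have hZpos : 0 < Z := integral_exp_pos hg
  have hρm : Measurable fun ω => ENNReal.ofReal (Real.exp (g ω) / Z) :=
    (hgm.exp.div_const Z).ennreal_ofReal
  have hfw : Integrable (fun ω => (ENNReal.ofReal (Real.exp (g ω) / Z)).toReal • f ω) μ :=
    (integrable_withDensity_iff_integrable_smul' hρm
      (Eventually.of_forall fun _ => ENNReal.ofReal_lt_top)).1 hf
  have hgf : Integrable (fun ω => Real.exp (g ω) • f ω) μ := by
    have hc : (fun ω => Real.exp (g ω) • f ω)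
        = fun ω => Z • ((ENNReal.ofReal (Real.exp (g ω) / Z)).toReal • f ω) := by
      funext ω
      rw [ENNReal.toReal_ofReal (by positivity), smul_smul, mul_div_cancel₀ _ hZpos.ne']
    rw [hc]; exact hfw.smul Z
  have hsm : StronglyMeasurable (fun ω => Real.exp (g ω) • f ω) := hexp.smul hfm
  have h2 := condExp_comap_ae_eq_integral_comp_recon (E := E) hT hS hJ hR hRTS hsm hgf
  have hac : μ.tilted g ≪ μ := tilted_absolutelyContinuous μ g
  filter_upwards [key, hac.ae_le h1, hac.ae_le h2] with ω hω h1ω h2ω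
  rw [hω, h1ω, h2ω]


/-! ## Appendix (v1.1): the DENSITY version — joint law absolutely continuous with respect to a product

If the joint law of `(T, S)` is not a product but has a DENSITY `J` with respect to one,
`μ ∘ (T,S)⁻¹ = J · (ν ⊗ π)`, the conditional expectation given `σ(S)` is the `J`-weighted fibre
average (Bayes' rule with the conditional density `a ↦ J(a, s) / ∫ J(·, s) dν`): Kallenberg's
disintegration formula (FMP 2nd ed. Thm 6.4, eq. (6)) with the explicit kernel
`μ(s, da) = J(a,s) ν(da) / ∫ J(a',s) ν(da')`, obtained here as (abstract Bayes formula of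
`CondExpBayes.lean`, Bain–Crisan 2009 Prop. 3.16) ∘ (the product case above) ∘ (naturality of the
conditional expectation under pull-back, `condExp_comp_ae_eq_condExp_map_comp`).  Where the fibre
normalisation `∫ J(a, s) ν(da)` vanishes the right-hand side is Lean's junk value `0⁻¹ • 0 = 0`; that
set of `s` is null for the law of `S`, so no positivity hypothesis is needed.  (Breiman, *Probability*
(1992) §4.1, Def. 4.15 and Problems 2–3, is the textbook `ℝ²`/Lebesgue instance: «one version of
`E(Y | X = x)` is given by `∫ y f(y,x)/f(x) dy`», «any σ-finite product measure could be used instead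
of `dy dx`».) -/

section Density

/-- **Naturality of the conditional expectation under pull-back.**  For a measurable `φ : Ω → Z`, a
sub-σ-algebra `m' ≤ 𝓩` on the target and `f` integrable for the image law `μ ∘ φ⁻¹`:
`μ[f ∘ φ | φ⁻¹(m')] = (μ∘φ⁻¹)[f | m'] ∘ φ`  `μ`-a.e. — the defining property of the conditional
expectation transported by the change-of-variables formula (Kallenberg FMP 2nd ed., Lemma 1.22
(substitution) with the a.s. uniqueness in Thm 6.1). [cite: Kallenberg2002, Lemma 1.22 and Thm 6.1] -/
theorem condExp_comp_ae_eq_condExp_map_comp {Z : Type*} {m' mZ : MeasurableSpace Z}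
    [IsFiniteMeasure μ] {φ : Ω → Z} (hφ : Measurable[inferInstance, mZ] φ) (hm' : m' ≤ mZ)
    {f : Z → E} (hf : Integrable f (μ.map φ)) :
    μ[f ∘ φ | m'.comap φ] =ᵐ[μ] (fun z => ((μ.map φ)[f | m']) z) ∘ φ := by
  haveI : IsFiniteMeasure (μ.map φ) := Measure.isFiniteMeasure_map μ φ
  have hm : m'.comap φ ≤ (inferInstance : MeasurableSpace Ω) :=
    (MeasurableSpace.comap_mono hm').trans hφ.comap_le
  have hφm : Measurable[m'.comap φ, m'] φ := measurable_iff_comap_le.2 le_rfl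
  have hfφ : Integrable (f ∘ φ) μ := (integrable_map_measure hf.1 hφ.aemeasurable).1 hf
  -- the candidate: the image-side conditional expectation read through `φ`
  have hgZ : StronglyMeasurable[m'] ((μ.map φ)[f | m']) := stronglyMeasurable_condExp
  have hgZ' : StronglyMeasurable ((μ.map φ)[f | m']) := hgZ.mono hm'
  have hgi : Integrable ((fun z => ((μ.map φ)[f | m']) z) ∘ φ) μ :=
    (integrable_map_measure hgZ'.aestronglyMeasurable hφ.aemeasurable).1 integrable_condExp
  have hgm : StronglyMeasurable[m'.comap φ] ((fun z => ((μ.map φ)[f | m']) z) ∘ φ) :=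
    hgZ.comp_measurable hφm
  refine (ae_eq_condExp_of_forall_setIntegral_eq hm hfφ (fun s _ _ => hgi.integrableOn) ?_
    hgm.aestronglyMeasurable).symm
  rintro _ ⟨B, hB, rfl⟩ -
  have hBZ : MeasurableSet B := hm' _ hB
  have e1 : ∫ x in φ ⁻¹' B, ((fun z => ((μ.map φ)[f | m']) z) ∘ φ) x ∂μ
      = ∫ z in B, ((μ.map φ)[f | m']) z ∂(μ.map φ) :=
    (setIntegral_map hBZ hgZ'.aestronglyMeasurable hφ.aemeasurable).symm
  have e2 : ∫ z in B, ((μ.map φ)[f | m']) z ∂(μ.map φ) = ∫ z in B, f z ∂(μ.map φ) :=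
    setIntegral_condExp hm' hf hB
  have e3 : ∫ z in B, f z ∂(μ.map φ) = ∫ x in φ ⁻¹' B, (f ∘ φ) x ∂μ :=
    setIntegral_map hBZ hf.1 hφ.aemeasurable
  rw [e1, e2, e3]

/-- **Conditional expectation given the second coordinate under a density** (product-space form;
Kallenberg FMP 2nd ed. Thm 6.4 eq. (6) with the density kernel; Bain–Crisan 2009 Prop. 3.16 for the
Bayes step): for a probability `ν` on `A`, a finite measure `π` on `B`, a measurable density
`J : A × B → ℝ≥0∞` with `∫ J d(ν ⊗ π) < ∞`, and `F` strongly measurable and `J·(ν ⊗ π)`-integrable,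
`(J·(ν⊗π))[F | σ(snd)] (a₀, s) = (∫ J(a,s) dν)⁻¹ • ∫ J(a,s) • F(a,s) dν(a)` for `J·(ν⊗π)`-a.e. `(a₀, s)`
(real weights `J.toReal`). [cite: Kallenberg2002, Thm 6.4 eq. (6); BainCrisan2009, Prop. 3.16] -/
theorem condExp_comap_snd_withDensity_prod_ae_eq [IsProbabilityMeasure ν] [IsFiniteMeasure π]
    {J : A × B → ℝ≥0∞} (hJm : Measurable J) (hJi : ∫⁻ z, J z ∂(ν.prod π) ≠ ∞)
    {F : A × B → E} (hF : StronglyMeasurable F) (hFi : Integrable F ((ν.prod π).withDensity J)) :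
    ((ν.prod π).withDensity J)[F | MeasurableSpace.comap Prod.snd inferInstance]
      =ᵐ[(ν.prod π).withDensity J]
      fun z => (∫ a, (J (a, z.2)).toReal ∂ν)⁻¹ • ∫ a, (J (a, z.2)).toReal • F (a, z.2) ∂ν := by
  set lam0 : Measure (A × B) := ν.prod π with hlam0
  have hm : MeasurableSpace.comap (Prod.snd : A × B → B) inferInstance
      ≤ (inferInstance : MeasurableSpace (A × B)) := measurable_snd.comap_le
  -- abstract Bayes formula for the density `J`
  have key := condExp_withDensity_ae_eq_smul (E := E) (μ := lam0) hm hJm hJi hFi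
  -- the two `lam0`-conditional expectations are plain fibre integrals (product case, `T = fst`)
  have hJ0 : lam0.map (fun z : A × B => (z.1, z.2)) = ν.prod π := by
    have : (fun z : A × B => (z.1, z.2)) = id := funext fun z => rfl
    rw [this, Measure.map_id]
  have hJlt : ∀ᵐ z ∂lam0, J z < ∞ := ae_lt_top hJm hJi
  have hJr : StronglyMeasurable (fun z : A × B => (J z).toReal) :=
    hJm.ennreal_toReal.stronglyMeasurable
  have hJri : Integrable (fun z : A × B => (J z).toReal) (ν.prod π) :=
    integrable_toReal_of_lintegral_ne_top hJm.aemeasurable hJi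
  have hJF : StronglyMeasurable (fun z : A × B => (J z).toReal • F z) := hJr.smul hF
  have hJFi : Integrable (fun z : A × B => (J z).toReal • F z) (ν.prod π) :=
    (integrable_withDensity_iff_integrable_smul' hJm hJlt).1 hFi
  have h1 := condExp_comap_ae_eq_integral_of_map_prod (E := ℝ) (μ := lam0)
    measurable_fst measurable_snd hJ0 hJr hJri
  have h2 := condExp_comap_ae_eq_integral_of_map_prod (E := E) (μ := lam0)
    measurable_fst measurable_snd hJ0 hJF hJFi
  have hac : lam0.withDensity J ≪ lam0 := withDensity_absolutelyContinuous lam0 J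
  filter_upwards [key, hac.ae_le h1, hac.ae_le h2] with z hz h1z h2z
  rw [hz]
  -- `h1z`, `h2z` are stated for `fun z => (J (z.1, z.2)).toReal …`; rewrite and close
  simp only [Prod.mk.eta] at h1z h2z
  rw [h1z, h2z]

/-- **Conditional expectation given `S` when the joint law of `(T, S)` has a density with respect to a
product** (Kallenberg FMP 2nd ed. Thm 6.4 eq. (6), density kernel; Bayes step Bain–Crisan 2009
Prop. 3.16): `μ` finite, `T`, `S` measurable with `μ ∘ (T,S)⁻¹ = J · (ν ⊗ π)` (`ν` probability, `π`
finite, `J` measurable), `F` strongly measurable with `F(T,S)` `μ`-integrable.  Then `μ`-a.e.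
`μ[F(T,S) | σ(S)] (ω) = (∫ J(a, S ω) dν(a))⁻¹ • ∫ J(a, S ω) • F(a, S ω) dν(a)`.  No positivity of the
fibre normalisation is assumed (where it vanishes both sides' contributions are null).
[cite: Kallenberg2002, Thm 6.4 eq. (6); BainCrisan2009, Prop. 3.16] -/
theorem condExp_comap_ae_eq_of_map_eq_withDensity_prod [IsFiniteMeasure μ] [IsProbabilityMeasure ν]
    [IsFiniteMeasure π] (hT : Measurable T) (hS : Measurable S)
    {J : A × B → ℝ≥0∞} (hJm : Measurable J)
    (hJ : μ.map (fun ω => (T ω, S ω)) = (ν.prod π).withDensity J)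
    {F : A × B → E} (hF : StronglyMeasurable F) (hFi : Integrable (fun ω => F (T ω, S ω)) μ) :
    μ[fun ω => F (T ω, S ω) | MeasurableSpace.comap S inferInstance]
      =ᵐ[μ] fun ω => (∫ a, (J (a, S ω)).toReal ∂ν)⁻¹ • ∫ a, (J (a, S ω)).toReal • F (a, S ω) ∂ν := by
  have hpair : Measurable (fun ω => (T ω, S ω)) := hT.prodMk hS
  -- integrability on the image side and finiteness of the density integral
  have hFi' : Integrable F (μ.map fun ω => (T ω, S ω)) :=
    (integrable_map_measure hF.aestronglyMeasurable hpair.aemeasurable).2 hFi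
  have hFiJ : Integrable F ((ν.prod π).withDensity J) := hJ ▸ hFi'
  have hJi : ∫⁻ z, J z ∂(ν.prod π) ≠ ∞ := by
    have h1 : ((ν.prod π).withDensity J) Set.univ = ∫⁻ z, J z ∂(ν.prod π) := by
      rw [withDensity_apply _ MeasurableSet.univ, Measure.restrict_univ]
    rw [← h1, ← hJ]
    exact measure_ne_top _ _
  -- naturality: pull the image-side conditional expectation back along `(T, S)`
  have hcomap : MeasurableSpace.comap S (inferInstance : MeasurableSpace B)
      = (MeasurableSpace.comap (Prod.snd : A × B → B) inferInstance).comap fun ω => (T ω, S ω) := by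
    rw [MeasurableSpace.comap_comp]; rfl
  have hnat := condExp_comp_ae_eq_condExp_map_comp (E := E) (μ := μ)
    (m' := MeasurableSpace.comap (Prod.snd : A × B → B) inferInstance) hpair
    measurable_snd.comap_le hFi'
  have himg := condExp_comap_snd_withDensity_prod_ae_eq (E := E) hJm hJi hF hFiJ
  rw [← hJ] at himg
  have hpull := ae_eq_comp hpair.aemeasurable himg
  rw [hcomap]
  refine hnat.trans ?_
  filter_upwards [hpull] with ω hω
  simpa only [Function.comp_apply] using hω

/-- **Resampling the fibre with a density, along a reconstruction map** (the `R`-form of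
`condExp_comap_ae_eq_of_map_eq_withDensity_prod`): if moreover `R : A × B → Ω` is measurable with
`R (T ω, S ω) = ω`, then for every strongly measurable `μ`-integrable `f : Ω → E`, `μ`-a.e.,
`μ[f | σ(S)] (ω) = (∫ J(a, S ω) dν(a))⁻¹ • ∫ J(a, S ω) • f (R (a, S ω)) dν(a)`.
[cite: Kallenberg2002, Thm 6.4 eq. (6); BainCrisan2009, Prop. 3.16] -/
theorem condExp_comap_ae_eq_density_comp_recon [IsFiniteMeasure μ] [IsProbabilityMeasure ν]
    [IsFiniteMeasure π] (hT : Measurable T) (hS : Measurable S)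
    {J : A × B → ℝ≥0∞} (hJm : Measurable J)
    (hJ : μ.map (fun ω => (T ω, S ω)) = (ν.prod π).withDensity J)
    {R : A × B → Ω} (hR : Measurable R) (hRTS : ∀ ω, R (T ω, S ω) = ω)
    {f : Ω → E} (hfm : StronglyMeasurable f) (hfi : Integrable f μ) :
    μ[f | MeasurableSpace.comap S inferInstance]
      =ᵐ[μ] fun ω => (∫ a, (J (a, S ω)).toReal ∂ν)⁻¹ •
        ∫ a, (J (a, S ω)).toReal • f (R (a, S ω)) ∂ν := by
  have hF : StronglyMeasurable (fun p : A × B => f (R p)) := hfm.comp_measurable hR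
  have hrec : (fun ω => f (R (T ω, S ω))) = f := funext fun ω => congrArg f (hRTS ω)
  have hFi : Integrable (fun ω => f (R (T ω, S ω))) μ := by rw [hrec]; exact hfi
  have h := condExp_comap_ae_eq_of_map_eq_withDensity_prod (E := E) hT hS hJm hJ hF hFi
  rw [hrec] at h
  exact h

end Density

end Literature.Probability.Process
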